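import Literature.Barriers.AtomisticToContinuum.OneDimensionalHardCoreRodsCoV
import HarnessLib

/-!
# Hard rods: assembly — no condensation in the Nagamiya hard-rod ground state for `ρa < 1/2`

`Literature/Barriers/AtomisticToContinuum/` (D-0021 barrier catalogue), sub-problem
`BoseEinsteinCondensation`; the typed proof of the rod barrier `OneDimensionalHardRods`
(`OneDimensionalHardCoreRods.lean`, eighth audit of `OneDimensionalHardCore`, 2026-08-16) for every
packing fraction `η = ρa < 1/2`.

Assembly of the chain. By translation invariance `c₀(N) = ∫₀ᴸ ρ_N(0, s) ds`
(`rodZeroMomentumOccupation_eq_integral_shift`), i.e. `c₀(N) = N ∫_{[0,L]×[0,L]ⁿ} Ψ(X,0)Ψ(X,s)`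
as a Lebesgue integral over the tagged phase space (`rodZeroMomentumOccupation_eq_lintegral`);
the excluded-volume change of variables bounds this by `(L'/L) ∫₀^{L'+a} ρ̃(t) dt`
(`lintegral_rodPairFun_le_lintegral_density`), the compressed density by the majorant
`ρ̃(t) ≤ (N/L') e^{1/2} M(t)` (`rodCompressedDensity_le_rodMajorant`, Lenard's formula, the
adjugate bound, the Hilbert–Schmidt deficiency of the rod matrix), so that
`c₀(N)/N ≤ e^{1/2} L⁻¹ ∫₀^{L'+a} M` (`rodZeroMomentumOccupation_le`); along `L = N/ρ`,
`L' = N(1/ρ − a)`, with the phase angle `θ = πρa/(2(1−ρa)) < π/2` iff `ρa < 1/2`, the right side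
tends to `0` (`tendsto_rodMajorant_integral`): **`c₀(N)/N → 0` for hard rods of length `a` at
every density `ρ` with `ρa < 1/2`** (`oneDimensionalHardRods_of_lt_half`), which is the statement
`OneDimensionalHardRods` of `OneDimensionalHardCoreRods.lean` (`OneDimensionalHardRods_holds`).

## References

* [MazzantiEtAl2008] F. Mazzanti, G. E. Astrakharchik, J. Boronat, J. Casulleras, Phys. Rev. Lett.
  100 (2008) 020401: Eqs. (2)–(5), p. 4.
* [Nagamiya1940] T. Nagamiya, Proc. Phys.-Math. Soc. Japan 22 (1940) 705.
* [ForresterEtAl2003] P. J. Forrester, N. E. Frankel, T. M. Garoni, N. S. Witte, Phys. Rev. A 67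
  (2003) 043607, §2.
-/

noncomputable section

open MeasureTheory Set Filter Topology
open scoped BigOperators Real ENNReal

namespace Literature.Barriers.AtomisticToContinuum.BoseGas

variable {n : ℕ} {L a : ℝ}

/-- `c₀ ≥ 0` for `L ≥ 0`. [folklore] -/
theorem rodZeroMomentumOccupation_nonneg (N : ℕ) (hL : 0 ≤ L) (a : ℝ) :
    0 ≤ rodZeroMomentumOccupation N L a := by
  unfold rodZeroMomentumOccupation
  exact mul_nonneg (inv_nonneg.mpr hL) (setIntegral_nonneg measurableSet_Icc fun x _ =>
    setIntegral_nonneg measurableSet_Icc fun y _ => rodDensityMatrix_nonneg _ _ _ _ _)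

/-- `F(s, ·)` is integrable on the box. [folklore] -/
theorem integrableOn_rodPairFun_slice (n : ℕ) (L a s : ℝ) :
    IntegrableOn (fun X => rodPairFun n L a (s, X)) (Set.pi Set.univ (fun _ : Fin n => Set.Icc (0 : ℝ) L))
      volume := by
  refine IntegrableOn.of_bound (volume_pi_lt_top (by rw [Real.volume_Icc]; exact ENNReal.ofReal_lt_top))
    (((measurable_rodPairFun n L a).comp measurable_prodMk_left).aestronglyMeasurable)
    ((Real.sqrt ((L - (n + 1 : ℕ) * a) / L) * ((Real.sqrt ((n + 1).factorial *
      (L - (n + 1 : ℕ) * a) ^ (n + 1)))⁻¹ * 2 ^ ((n + 1) * (n + 1)))) ^ 2)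
    (Eventually.of_forall fun X => ?_)
  rw [Real.norm_eq_abs, abs_of_nonneg (rodPairFun_nonneg _ _ _ _)]
  exact rodPairFun_le _ _ _ _

/-- **`c₀` as a Lebesgue integral over the tagged phase space**:
`c₀(N) = N ∫_{[0,L]×[0,L]ⁿ} Ψ(X,0)Ψ(X,s) dX ds`. [cite: MazzantiEtAl2008, p. 3] -/
theorem rodZeroMomentumOccupation_eq_lintegral (hL : 0 < L) (a : ℝ) :
    rodZeroMomentumOccupation (n + 1) L a = (n + 1 : ℝ) *
      (∫⁻ p in Set.Icc 0 L ×ˢ Set.pi Set.univ (fun _ : Fin n => Set.Icc (0 : ℝ) L),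
        ENNReal.ofReal (rodPairFun n L a p)
          ∂((volume : Measure ℝ).prod (volume : Measure (Fin n → ℝ)))).toReal := by
  set box := Set.pi Set.univ (fun _ : Fin n => Set.Icc (0 : ℝ) L) with hbox
  set f : ℝ × (Fin n → ℝ) → ℝ≥0∞ := fun p => ENNReal.ofReal (rodPairFun n L a p) with hf
  have hfm : Measurable f := (measurable_rodPairFun n L a).ennreal_ofReal
  have hρ : ∀ s, ENNReal.ofReal (rodDensityMatrix (n + 1) L a 0 s) =
      ENNReal.ofReal (n + 1) * ∫⁻ X in box, f (s, X) := by
    intro s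
    have hdef : rodDensityMatrix (n + 1) L a 0 s = (n + 1 : ℝ) * ∫ X in box, rodPairFun n L a (s, X) := rfl
    rw [hdef, ENNReal.ofReal_mul (by positivity), ofReal_integral_eq_lintegral_ofReal
      (integrableOn_rodPairFun_slice n L a s) (Eventually.of_forall fun X => rodPairFun_nonneg _ _ _ _)]
  rw [rodZeroMomentumOccupation_eq_integral_shift hL a,
    integral_eq_lintegral_of_nonneg_ae (Eventually.of_forall fun s => rodDensityMatrix_nonneg _ _ _ _ _)
      (measurable_rodDensityMatrix_zero n L a).aestronglyMeasurable]
  simp_rw [hρ]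
  rw [lintegral_const_mul' _ _ ENNReal.ofReal_ne_top, ENNReal.toReal_mul,
    ENNReal.toReal_ofReal (by positivity)]
  congr 2
  rw [← Measure.prod_restrict, lintegral_prod _ hfm.aemeasurable]

/-- **The bound on `c₀`**: for `0 < a ≤ L' = L − Na` and a phase angle `θ ∈ [πna/(2L'), π/2]`,
`c₀(N) ≤ N e^{1/2} L⁻¹ ∫₀^{L'+a} M(t) dt`. [cite: MazzantiEtAl2008, Eqs. (2)–(5)] -/
theorem rodZeroMomentumOccupation_le (hL : 0 < L) (ha : 0 ≤ a) (hLp : 0 < L - ((n + 1 : ℕ) : ℝ) * a)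
    (haL : a ≤ L - ((n + 1 : ℕ) : ℝ) * a) {θ : ℝ}
    (hθ1 : π * n * a / (2 * (L - ((n + 1 : ℕ) : ℝ) * a)) ≤ θ) (hθ2 : θ ≤ π / 2) :
    rodZeroMomentumOccupation (n + 1) L a ≤
      (n + 1 : ℝ) * (Real.exp (1 / 2) / L *
        ∫ t in Set.Icc 0 (L - ((n + 1 : ℕ) : ℝ) * a + a), rodMajorant n (L - ((n + 1 : ℕ) : ℝ) * a) a θ t) := by
  set Lp := L - ((n + 1 : ℕ) : ℝ) * a with hLpdef
  set I := ∫ t in Set.Icc 0 (Lp + a), rodMajorant n Lp a θ t with hI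
  have hM_int : IntegrableOn (fun t => rodMajorant n Lp a θ t) (Set.Icc 0 (Lp + a)) volume := by
    refine IntegrableOn.of_bound (by rw [Real.volume_Icc]; exact ENNReal.ofReal_lt_top)
      (measurable_rodMajorant n Lp a θ).aestronglyMeasurable 1 (Eventually.of_forall fun t => ?_)
    rw [Real.norm_eq_abs, abs_of_nonneg (rodMajorant_nonneg _ _ _ _ _)]
    exact rodMajorant_le_one _ _ _ _ _
  have hI0 : 0 ≤ I := setIntegral_nonneg measurableSet_Icc fun t _ => rodMajorant_nonneg _ _ _ _ _
  -- the Lebesgue-integral chain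
  have hchain : ∫⁻ p in Set.Icc 0 L ×ˢ Set.pi Set.univ (fun _ : Fin n => Set.Icc (0 : ℝ) L),
      ENNReal.ofReal (rodPairFun n L a p) ∂((volume : Measure ℝ).prod (volume : Measure (Fin n → ℝ))) ≤
      ENNReal.ofReal (Lp / L * (Real.exp (1 / 2) / Lp * I)) := by
    refine (lintegral_rodPairFun_le_lintegral_density hL ha hLp.le).trans ?_
    rw [ENNReal.ofReal_mul (div_nonneg hLp.le hL.le)]
    gcongr
    calc ∫⁻ t in Set.Icc 0 (Lp + a), ENNReal.ofReal (rodCompressedDensity n Lp a t / (n + 1))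
        ≤ ∫⁻ t in Set.Icc 0 (Lp + a), ENNReal.ofReal (Real.exp (1 / 2) / Lp * rodMajorant n Lp a θ t) := by
          refine setLIntegral_mono ((measurable_rodMajorant n Lp a θ).const_mul _).ennreal_ofReal
            fun t ht => ENNReal.ofReal_le_ofReal ?_
          rw [div_le_iff₀ (by positivity : (0 : ℝ) < n + 1)]
          calc rodCompressedDensity n Lp a t
              ≤ (n + 1 : ℝ) / Lp * Real.exp (1 / 2) * rodMajorant n Lp a θ t :=
                rodCompressedDensity_le_rodMajorant hLp ha haL hθ1 hθ2 ht
            _ = Real.exp (1 / 2) / Lp * rodMajorant n Lp a θ t * (n + 1) := by ring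
      _ = ENNReal.ofReal (∫ t in Set.Icc 0 (Lp + a), Real.exp (1 / 2) / Lp * rodMajorant n Lp a θ t) := by
          rw [ofReal_integral_eq_lintegral_ofReal (hM_int.const_mul _)
            (Eventually.of_forall fun t => mul_nonneg (by positivity) (rodMajorant_nonneg _ _ _ _ _))]
      _ = ENNReal.ofReal (Real.exp (1 / 2) / Lp * I) := by rw [integral_const_mul]
  rw [rodZeroMomentumOccupation_eq_lintegral hL a]
  refine mul_le_mul_of_nonneg_left ?_ (by positivity)
  have hfin := ENNReal.toReal_le_of_le_ofReal (by positivity) hchain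
  calc _ ≤ Lp / L * (Real.exp (1 / 2) / Lp * I) := hfin
    _ = Real.exp (1 / 2) / L * I := by field_simp

/-- **No condensation in the hard-rod ground state for `ρa < 1/2`**: for rods of length `a ≥ 0` at
density `ρ > 0` with `ρa < 1/2`, `c₀(N)/N → 0` along `L = N/ρ` — the typed content of the rod
barrier `OneDimensionalHardRods` below the first commensurate packing fraction (there the phase
angle `θ = πρa/(2(1−ρa))` of the deficiency bound stays below `π/2`).
[cite: MazzantiEtAl2008, Eqs. (2)–(5) and p. 4] [cite: Nagamiya1940] -/
theorem oneDimensionalHardRods_of_lt_half (a : ℝ) (ha : 0 ≤ a) (ρ : ℝ) (hρ : 0 < ρ) (h : ρ * a < 1 / 2) :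
    Tendsto (fun N : ℕ => rodZeroMomentumOccupation N (N / ρ) a / N) atTop (𝓝 0) := by
  set ℓ : ℝ := 1 / ρ - a with hℓ
  have haρ : a * ρ < 1 / 2 := by rw [mul_comm]; exact h
  have hℓ_pos : 0 < ℓ := by
    rw [hℓ, sub_pos, lt_div_iff₀ hρ]; linarith
  have haℓ : a < ℓ := by
    rw [hℓ, lt_sub_iff_add_lt, lt_div_iff₀ hρ]; linarith
  set θ : ℝ := π * a / (2 * ℓ) with hθ
  have hθ_nonneg : 0 ≤ θ := by positivity
  have hθ_lt : θ < π / 2 := by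
    rw [hθ, div_lt_div_iff₀ (by positivity) (by norm_num : (0 : ℝ) < 2)]
    nlinarith [Real.pi_pos]
  have hcos : Real.cos θ ≠ 0 := (Real.cos_pos_of_mem_Ioo ⟨by linarith [Real.pi_pos], hθ_lt⟩).ne'
  -- eventually the rods fit with room: `a ≤ L' = Nℓ`
  have hev : ∀ᶠ n : ℕ in atTop, a ≤ (n + 1 : ℝ) * ℓ := by
    refine (eventually_ge_atTop ⌈a / ℓ⌉₊).mono fun n hn => ?_
    have h1 : a / ℓ ≤ n := (Nat.le_ceil _).trans (by exact_mod_cast hn)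
    rw [div_le_iff₀ hℓ_pos] at h1
    nlinarith
  -- the bound at `N = n + 1`
  have key : ∀ n : ℕ, a ≤ (n + 1 : ℝ) * ℓ →
      rodZeroMomentumOccupation (n + 1) (((n + 1 : ℕ) : ℝ) / ρ) a / ((n + 1 : ℕ) : ℝ) ≤
        Real.exp (1 / 2) * (((n + 1 : ℝ) * ℓ)⁻¹ *
          ∫ t in Set.Icc 0 ((n + 1 : ℝ) * ℓ + a), rodMajorant n ((n + 1 : ℝ) * ℓ) a θ t) := by
    intro n hn
    have hN : ((n + 1 : ℕ) : ℝ) = n + 1 := by push_cast; ring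
    set L : ℝ := ((n + 1 : ℕ) : ℝ) / ρ with hLdef
    have hLp_eq : L - ((n + 1 : ℕ) : ℝ) * a = (n + 1 : ℝ) * ℓ := by rw [hLdef, hN, hℓ]; ring
    have hL_pos : 0 < L := by rw [hLdef, hN]; positivity
    have hLp_pos : 0 < L - ((n + 1 : ℕ) : ℝ) * a := by rw [hLp_eq]; positivity
    have haL : a ≤ L - ((n + 1 : ℕ) : ℝ) * a := by rw [hLp_eq]; exact hn
    have hθ1 : π * n * a / (2 * (L - ((n + 1 : ℕ) : ℝ) * a)) ≤ θ := by
      rw [hLp_eq, hθ, div_le_div_iff₀ (by positivity) (by positivity)]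
      nlinarith [Real.pi_pos, mul_nonneg (mul_nonneg Real.pi_pos.le ha) hℓ_pos.le]
    have hbound := rodZeroMomentumOccupation_le hL_pos ha hLp_pos haL hθ1 hθ_lt.le
    rw [hLp_eq] at hbound
    set I := ∫ t in Set.Icc 0 ((n + 1 : ℝ) * ℓ + a), rodMajorant n ((n + 1 : ℝ) * ℓ) a θ t with hI
    have hI0 : 0 ≤ I := setIntegral_nonneg measurableSet_Icc fun t _ => rodMajorant_nonneg _ _ _ _ _
    have hLge : (n + 1 : ℝ) * ℓ ≤ L := by
      rw [← hLp_eq, sub_le_self_iff]; positivity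
    have h1 : Real.exp (1 / 2) / L ≤ Real.exp (1 / 2) * ((n + 1 : ℝ) * ℓ)⁻¹ := by
      rw [div_eq_mul_inv]
      exact mul_le_mul_of_nonneg_left (inv_anti₀ (by positivity) hLge) (Real.exp_pos _).le
    rw [hN, div_le_iff₀ (by positivity : (0 : ℝ) < n + 1)]
    calc rodZeroMomentumOccupation (n + 1) L a ≤ (n + 1 : ℝ) * (Real.exp (1 / 2) / L * I) := hbound
      _ ≤ (n + 1 : ℝ) * (Real.exp (1 / 2) * ((n + 1 : ℝ) * ℓ)⁻¹ * I) :=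
          mul_le_mul_of_nonneg_left (mul_le_mul_of_nonneg_right h1 hI0) (by positivity)
      _ = Real.exp (1 / 2) * (((n + 1 : ℝ) * ℓ)⁻¹ * I) * (n + 1) := by ring
  -- the majorant side tends to zero
  have hu : Tendsto (fun n : ℕ => Real.exp (1 / 2) * (((n + 1 : ℝ) * ℓ)⁻¹ *
      ∫ t in Set.Icc 0 ((n + 1 : ℝ) * ℓ + a), rodMajorant n ((n + 1 : ℝ) * ℓ) a θ t)) atTop (𝓝 0) := by
    simpa using (tendsto_rodMajorant_integral hℓ_pos ha hcos).const_mul (Real.exp (1 / 2))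
  refine (tendsto_add_atTop_iff_nat 1).mp ?_
  refine tendsto_of_tendsto_of_tendsto_of_le_of_le' tendsto_const_nhds hu
    (Eventually.of_forall fun n => ?_) (hev.mono fun n hn => key n hn)
  exact div_nonneg (rodZeroMomentumOccupation_nonneg _ (by positivity) _) (Nat.cast_nonneg _)

/-- The rod barrier restricted to `ρa < 1/2`, in the shape of `OneDimensionalHardRods`. [folklore] -/
theorem oneDimensionalHardRods_lt_half :
    ∀ a : ℝ, 0 ≤ a → ∀ ρ : ℝ, 0 < ρ → ρ * a < 1 / 2 →
      Tendsto (fun N : ℕ => rodZeroMomentumOccupation N (N / ρ) a / N) atTop (𝓝 0) :=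
  fun a ha ρ hρ h => oneDimensionalHardRods_of_lt_half a ha ρ hρ h

end Literature.Barriers.AtomisticToContinuum.BoseGas

namespace Literature.Barriers.AtomisticToContinuum

open BoseGas

/-- **The rod barrier `OneDimensionalHardRods` is a theorem of the tree**: for every rod length
`a ≥ 0` and density `ρ > 0` with `ρa < 1/2`, `c₀(N, N/ρ, a)/N → 0` for the Nagamiya hard-rod
ground state (`oneDimensionalHardRods_of_lt_half`). [cite: MazzantiEtAl2008, Eqs. (2)–(5)]
[cite: Nagamiya1940] -/
theorem OneDimensionalHardRods_holds : OneDimensionalHardRods :=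
  fun a ha ρ hρ h => oneDimensionalHardRods_of_lt_half a ha ρ hρ h

end Literature.Barriers.AtomisticToContinuum
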